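import Mathlib.RingTheory.Ideal.AssociatedPrime.Localization
import Mathlib.RingTheory.Ideal.AssociatedPrime.Finiteness
import Mathlib.RingTheory.Ideal.Colon
import Mathlib.RingTheory.Ideal.MinimalPrime.Basic
import Mathlib.RingTheory.Spectrum.Prime.Topology
import Mathlib.RingTheory.Spectrum.Prime.Noetherian
import Mathlib.RingTheory.Localization.FractionRing
import Mathlib.Topology.NoetherianSpace
import Mathlib.Topology.Sets.Closeds
import HarnessLib

/-!
# Finite generation of a module of fractions from local finite generation (Stacks 10.161.15, 10.161.14)

Topic: `Literature/AlgebraicGeometry/Resolution`. The globalisation step in the theory of Japanese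
rings, The Stacks Project Lemma 10.161.15: *"Let `R` be a Noetherian domain. Then `R` is N-1 if and
only if the following two conditions hold (1) there exists a nonzero `f ∈ R` such that `R_f` is
normal, and (2) for every maximal ideal `𝔪 ⊂ R` the local ring `R_𝔪` is N-1"*, whose proof rests
on Lemma 10.161.14 (*"Let `R` be a Noetherian domain. If there exists a nonzero `f ∈ R` such that
`R_f` is normal then `U = {𝔭 | R_𝔭 is normal}` is open"*) applied to the finite overrings
`R' = R[x_1, …, x_n]`: *"the set of primes `𝔭'` with `R'_{𝔭'}` non-normal is closed … `Z_{R'}` this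
image … we can find a finite collection `R ⊂ R'_i ⊂ K` such that `⋂ Z_{R'_i} = ∅` … `R'` is the
integral closure of `R` in `K`"*.

We PROVE the sufficiency ("(1) + (2) ⇒ N-1") as a statement about an arbitrary `B`-submodule
`N` of the fraction field `K` of a Noetherian domain `B` (to be applied to the integral closure):
`fg_of_forall_prime_locally_fg` — if `fⁿ N ⊆ B` elementwise for a fixed `f ≠ 0` and `N` is finitely
generated locally at every prime, then `N` is finitely generated. For a finitely generated
`B ⊆ C ⊆ K` the "bad set" `Z(C) = {𝔭 | N ⊄ C_𝔭}` is closed — in place of Serre's criterion in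
10.161.14 we note directly that `Z(C)` is the union of the `V(𝔮)` over the finitely many associated
primes `𝔮` of `C/fC` lying in `Z(C)` (a witness `z ∈ N`, `z ∉ C_𝔭`, `fz ∈ C` has
`(C : z) = Ann(fz mod fC)`, and a minimal prime of this annihilator inside `𝔭` is associated) — and
Noetherian induction on `Z(C)` in `Spec B` replaces the quasi-compactness argument.

No definitions, no named facts. Step 5a of the discharge of
`EGAIV2_7_7_4_finiteNormalization_completeLocal` (`FiniteNormalizationCompleteLocalBase.lean`).

## References

* [StacksProject] The Stacks Project, Tag 0BI1 (Section 10.161), Lemmas 10.161.14 and 10.161.15.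
-/

noncomputable section

open scoped Pointwise

namespace Literature.AlgebraicGeometry.Resolution

universe u

section Global

variable {B : Type u} [CommRing B] [IsNoetherianRing B] {K : Type u} [Field K]
  [Algebra B K] [IsFractionRing B K]

omit [IsNoetherianRing B] [IsFractionRing B K] in
/-- The "bad set" of a submodule `C ⊆ K` relative to `N`: the primes `𝔭` at which some element of
`N` is not in `C_𝔭`, i.e. `(C : y) ⊆ 𝔭` for some `y ∈ N`. If it is empty then `N ⊆ C`.
[cite: StacksProject, Tag 0BI1 (proof of Lemma 10.161.15, the sets `Z_{R'}`)] -/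
theorem le_of_forall_not_colon_le (N C : Submodule B K)
    (h : ∀ 𝔭 : PrimeSpectrum B, ¬ ∃ y ∈ N, C.colon {y} ≤ 𝔭.asIdeal) : N ≤ C := by
  intro y hy
  by_contra hyC
  have hne : C.colon {y} ≠ ⊤ := by
    intro htop
    have h1 : (1 : B) ∈ C.colon {y} := htop ▸ Submodule.mem_top
    rw [Submodule.mem_colon_singleton, one_smul] at h1
    exact hyC h1
  obtain ⟨𝔪, h𝔪, hle⟩ := Ideal.exists_le_maximal _ hne
  exact h ⟨𝔪, h𝔪.isPrime⟩ ⟨y, hy, hle⟩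

/-- **The bad set of a finitely generated `B ⊆ C ⊆ K` is closed** (the substitute for Stacks
10.161.14): if `C ∋ 1` is a finitely generated `B`-submodule of `K` and every `y ∈ N` has
`fⁿ y ∈ B` for some `n`, then `{𝔭 | ∃ y ∈ N, (C : y) ⊆ 𝔭}` is the union of the closed sets `V(𝔮)`
over the associated primes `𝔮` of `C/fC` belonging to it. [cite: StacksProject, Tag 0BI1 (Lemma 10.161.14)] -/
theorem isClosed_setOf_exists_colon_le (N C : Submodule B K) (hC : C.FG) (h1 : (1 : K) ∈ C)
    {f : B} (hf0 : f ≠ 0) (hf : ∀ y ∈ N, ∃ (n : ℕ) (b : B), algebraMap B K b = f ^ n • y) :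
    IsClosed {𝔭 : PrimeSpectrum B | ∃ y ∈ N, C.colon {y} ≤ 𝔭.asIdeal} := by
  classical
  -- the finite `B`-module `C/fC` and its associated primes
  let M := C ⧸ (f • (⊤ : Submodule B C))
  haveI : Module.Finite B C := Module.Finite.iff_fg.mpr hC
  haveI : Module.Finite B M := inferInstance
  have hfin : (associatedPrimes B M).Finite := associatedPrimes.finite B M
  let A : Set (Ideal B) := {𝔮 ∈ associatedPrimes B M | ∃ y ∈ N, C.colon {y} ≤ 𝔮}
  have hAfin : A.Finite := hfin.subset (Set.sep_subset _ _)
  suffices heq : {𝔭 : PrimeSpectrum B | ∃ y ∈ N, C.colon {y} ≤ 𝔭.asIdeal} =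
      ⋃ 𝔮 ∈ A, PrimeSpectrum.zeroLocus (𝔮 : Set B) by
    rw [heq]
    exact hAfin.isClosed_biUnion fun 𝔮 _ => PrimeSpectrum.isClosed_zeroLocus _
  ext 𝔭
  simp only [Set.mem_setOf_eq, Set.mem_iUnion, PrimeSpectrum.mem_zeroLocus, exists_prop]
  constructor
  · rintro ⟨y, hyN, hyle⟩
    -- a witness `z ∈ N` with `(C : z) ⊆ 𝔭` and `f z ∈ C`
    have hbase : ∀ y ∈ N, ∃ n : ℕ, ¬ C.colon {f ^ n • y} ≤ 𝔭.asIdeal := by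
      intro y hy
      obtain ⟨n, b, hb⟩ := hf y hy
      refine ⟨n, fun hle => 𝔭.2.ne_top ((Ideal.eq_top_iff_one _).mpr (hle ?_))⟩
      rw [Submodule.mem_colon_singleton, one_smul, ← hb, Algebra.algebraMap_eq_smul_one]
      exact C.smul_mem b h1
    obtain ⟨z, hzN, hzle, hfz⟩ : ∃ z ∈ N, C.colon {z} ≤ 𝔭.asIdeal ∧ f • z ∈ C := by
      let m := Nat.find (hbase y hyN)
      have hm : ¬ C.colon {f ^ m • y} ≤ 𝔭.asIdeal := Nat.find_spec (hbase y hyN)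
      have hm0 : m ≠ 0 := by
        intro h0
        rw [h0, pow_zero, one_smul] at hm
        exact hm hyle
      obtain ⟨k, hk⟩ := Nat.exists_eq_succ_of_ne_zero hm0
      have hk' : C.colon {f ^ k • y} ≤ 𝔭.asIdeal := by
        by_contra hnot
        exact Nat.find_min (hbase y hyN) (show k < m by omega) hnot
      -- `f^(k+1) y` has a multiplier `s ∉ 𝔭` into `C`
      obtain ⟨s, hsC, hs𝔭⟩ : ∃ s ∈ C.colon {f ^ (k + 1) • y}, s ∉ 𝔭.asIdeal :=
        Set.not_subset.mp (by have := hm; rw [hk] at this; exact this)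
      refine ⟨s • f ^ k • y, N.smul_mem s (N.smul_mem _ hyN), ?_, ?_⟩
      · intro b hb
        rw [Submodule.mem_colon_singleton, ← mul_smul] at hb
        have : b * s ∈ C.colon {f ^ k • y} := by
          rw [Submodule.mem_colon_singleton]; exact hb
        exact (𝔭.2.mem_or_mem (hk' this)).resolve_right hs𝔭
      · rw [Submodule.mem_colon_singleton] at hsC
        rw [smul_comm f s (f ^ k • y), smul_smul f (f ^ k) y, ← pow_succ']
        exact hsC
    -- `(C : z)` is the annihilator of `fz mod fC`
    let a : C := ⟨f • z, hfz⟩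
    let abar : M := Submodule.Quotient.mk a
    have hann : (Submodule.span B {abar}).annihilator = C.colon {z} := by
      ext b
      rw [Submodule.mem_annihilator_span_singleton, Submodule.mem_colon_singleton]
      change Submodule.Quotient.mk (b • a) = (0 : M) ↔ _
      rw [Submodule.Quotient.mk_eq_zero, Submodule.mem_smul_pointwise_iff_exists]
      constructor
      · rintro ⟨c, -, hc⟩
        have hc' : f • (c : K) = f • (b • z) := by
          have := congrArg Subtype.val hc
          simpa [a, smul_comm b f z] using this
        have hfK : algebraMap B K f ≠ 0 :=
          fun h => hf0 ((IsFractionRing.injective B K) (by rw [h, map_zero]))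
        rw [Algebra.smul_def, Algebra.smul_def] at hc'
        have : (c : K) = b • z := mul_left_cancel₀ hfK hc'
        rw [← this]; exact c.2
      · intro hbz
        refine ⟨⟨b • z, hbz⟩, Submodule.mem_top, Subtype.ext ?_⟩
        change f • (b • z) = b • (f • z)
        exact smul_comm f b z
    -- a minimal prime of `(C : z)` inside `𝔭` is an associated prime of `C/fC`
    obtain ⟨𝔮, h𝔮min, h𝔮le⟩ := Ideal.exists_minimalPrimes_le hzle
    refine ⟨𝔮, ⟨?_, z, hzN, h𝔮min.1.2⟩, h𝔮le⟩
    have h𝔮' : 𝔮 ∈ (Module.annihilator B (Submodule.span B {abar})).minimalPrimes := by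
      rw [← Submodule.annihilator, hann]; exact h𝔮min
    exact associatedPrimes.subset_of_injective (Submodule.span B {abar}).injective_subtype
      (Module.associatedPrimes.minimalPrimes_annihilator_subset_associatedPrimes B _ h𝔮')
  · rintro ⟨𝔮, ⟨-, y, hyN, hyle⟩, h𝔮𝔭⟩
    exact ⟨y, hyN, hyle.trans h𝔮𝔭⟩

/-- **Stacks 10.161.15, sufficiency, for a submodule of the fraction field.** Let `B` be a
Noetherian domain with fraction field `K`, `N ⊆ K` a `B`-submodule. Assume (1) there is `f ≠ 0`
with `fⁿ y ∈ B` for every `y ∈ N` (some `n` depending on `y`), and (2) `N` is finitely generated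
locally at every prime: finitely many elements of `N` generate `N_𝔭` over `B_𝔭`. Then `N` is a
finitely generated `B`-module. (Noetherian induction on the closed bad sets `Z(C)` of finitely
generated `C ⊆ K`, strictly shrinking `Z(C)` by adjoining local generators at a bad prime; when
`Z(C) = ∅`, `N ⊆ C`.) [cite: StacksProject, Tag 0BI1 (Lemma 10.161.15)] -/
theorem fg_of_forall_prime_locally_fg (N : Submodule B K) {f : B} (hf0 : f ≠ 0)
    (hf : ∀ y ∈ N, ∃ (n : ℕ) (b : B), algebraMap B K b = f ^ n • y)
    (hloc : ∀ 𝔭 : PrimeSpectrum B, ∃ S : Finset K, (S : Set K) ⊆ N ∧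
      ∀ y ∈ N, ∃ s ∉ 𝔭.asIdeal, s • y ∈ Submodule.span B (S : Set K)) :
    N.FG := by
  classical
  -- the bad set of `C`
  let Z : Submodule B K → Set (PrimeSpectrum B) := fun C =>
    {𝔭 : PrimeSpectrum B | ∃ y ∈ N, C.colon {y} ≤ 𝔭.asIdeal}
  have hZmono : ∀ C C' : Submodule B K, C ≤ C' → Z C' ⊆ Z C := by
    rintro C C' hCC' 𝔭 ⟨y, hy, hle⟩
    exact ⟨y, hy, (Submodule.colon_mono hCC' le_rfl).trans hle⟩
  -- Noetherian induction on a closed set containing `Z(C)`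
  suffices main : ∀ T : TopologicalSpace.Closeds (PrimeSpectrum B),
      (∃ C : Submodule B K, C.FG ∧ (1 : K) ∈ C ∧ Z C ⊆ T) → N.FG by
    let C₀ : Submodule B K := Submodule.span B {1}
    have hC₀ : C₀.FG := Submodule.fg_span (Set.finite_singleton _)
    have h1 : (1 : K) ∈ C₀ := Submodule.subset_span rfl
    exact main ⟨Z C₀, isClosed_setOf_exists_colon_le N C₀ hC₀ h1 hf0 hf⟩ ⟨C₀, hC₀, h1, subset_rfl⟩
  intro T
  induction T using WellFoundedLT.induction with
  | ind T ih =>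
    rintro ⟨C, hC, h1, hZT⟩
    by_cases hempty : Z C = ∅
    · -- `N ⊆ C`, finitely generated
      have hle : N ≤ C := le_of_forall_not_colon_le N C fun 𝔭 h𝔭 => by
        have : 𝔭 ∈ Z C := h𝔭
        rw [hempty] at this
        exact this
      haveI : IsNoetherian B C := isNoetherian_of_fg_of_noetherian C hC
      have : N = (N.comap C.subtype).map C.subtype := by
        rw [Submodule.map_comap_subtype, inf_eq_right.mpr hle]
      rw [this]
      exact (IsNoetherian.noetherian _).map _
    · obtain ⟨𝔭, h𝔭⟩ := Set.nonempty_iff_ne_empty.mpr hempty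
      obtain ⟨S, hSN, hS⟩ := hloc 𝔭
      let C' : Submodule B K := C ⊔ Submodule.span B (S : Set K)
      have hC' : C'.FG := hC.sup (Submodule.fg_span S.finite_toSet)
      have h1' : (1 : K) ∈ C' := Submodule.mem_sup_left h1
      have hZC' : Z C' ⊆ Z C := hZmono C C' le_sup_left
      have h𝔭C' : 𝔭 ∉ Z C' := by
        rintro ⟨y, hy, hle⟩
        obtain ⟨s, hs𝔭, hsy⟩ := hS y hy
        exact hs𝔭 (hle (Submodule.mem_colon_singleton.mpr (Submodule.mem_sup_right hsy)))
      let T' : TopologicalSpace.Closeds (PrimeSpectrum B) :=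
        ⟨Z C', isClosed_setOf_exists_colon_le N C' hC' h1' hf0 hf⟩
      have hlt : T' < T := by
        refine lt_of_le_of_ne (fun x hx => hZT (hZC' hx)) fun heq => h𝔭C' ?_
        have : (T' : Set (PrimeSpectrum B)) = T := congrArg SetLike.coe heq
        change 𝔭 ∈ (T' : Set (PrimeSpectrum B))
        rw [this]; exact hZT h𝔭
      exact ih T' hlt ⟨C', hC', h1', subset_rfl⟩

end Global

end Literature.AlgebraicGeometry.Resolution

end
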